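import Literature.MathematicalPhysics.KineticTheory.MetropolisOddStatistic
import Literature.MathematicalPhysics.KineticTheory.HardSphereEulerProofs
import HarnessLib

/-!
# The slab pressure bet split into a static centring bound and a centred bet (line `KineticSlabSketch`)

Crux `JParityClosure.OddContactSymmetry` (stmt-AtomisticToContinuum-17722, rev 5), line `KineticSlabSketch` (card
`kinetic-slab-entropy-spending`), lead `prover-line-stmt-AtomisticToContinuum-17722-c1-0` (cycle 2).  RESHAPE of the line's
registered open stub S1 `stub_slabPressure` (equilibrium one-slab exponential moments of the Metropolis-odd collision sum
`X = metroOddSum … (Ioc 0 ℓ) (χ(· + s, ·)) … r_K ϑ` at the kinetic mesoscale `r_K = K^{1/4}(N+1)^{-1/3}` under the invariant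
homogeneous Gibbs law `G_N = localGibbsLaw σ 1 0 θe`) into

* S1a `stub_slabCentring` — STATIC: the `G_N`-mean of the slab sum is `o(K(N+1))`: `|∫ X dG_N| ≤ y K (N+1)` for every
  `y > 0` once `K ≥ K₀(y, ϑ, …)` and `N ≥ N₀` (stationarity/Campbell under the invariant law, `HardSphereCampbellFormula`
  PROVED in tree; exact J-parity of the equilibrium contact law, `staticTubeParity`; the residual is the finite-sample bias of
  the Metropolis weight read off the `(4π/3)K^{3/4}`-particle kernel density estimate, `O((K^{3/4}ϑ³)^{-1/2})` per collision,
  plus the `O(ε/r_K) = O(σ K^{-1/4})` reading-point offset between the ordered twins `(i,j)`, `(j,i)`);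
* S1b `stub_slabPressureCentred` — THE BET proper: the same exponential-moment bound for the CENTRED sum `X − ∫ X dG_N`;

and the PROVED glue `slabPressure_of_centring_of_centred : S1a → S1b → S1` (this file):
`exp((b'/K)|X|) ≤ exp((b'/K)|X − m|) · exp((b'/K)|m|)` with `m = ∫ X dG_N`, `|m| ≤ (y/2) K (N+1)`, and the centred bound at
level `y/2`; `lintegral_mul_const'` (no measurability needed).  `∫ X dG_N` is the Bochner integral (junk `0` for a
non-integrable `X`, in which case S1b is S1 itself; `X` is in fact integrable: `|X| ≤ ‖χ g Ψ‖_∞ · 2 numCollisions` and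
`lintegral_numCollisions_le`).  Nothing is assumed: S1a and S1b enter as explicit hypotheses.
-/

noncomputable section

open scoped BigOperators Classical InnerProductSpace ENNReal Topology
open Set MeasureTheory Filter
open Literature.Analysis.FluidPDE Literature.MathematicalPhysics.KineticTheory

namespace Summit.AtomisticToContinuum.HydrodynamicLimit.Theorems.OddContactSymmetryKineticSlab

/-- Pointwise step of the glue: `exp(a|x|) ≤ exp(a|x − m|) · exp(a|m|)` for `a ≥ 0`, in `ℝ≥0∞`. [folklore] -/
theorem ofReal_exp_mul_abs_le (a x m : ℝ) (ha : 0 ≤ a) :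
    ENNReal.ofReal (Real.exp (a * |x|)) ≤
      ENNReal.ofReal (Real.exp (a * |x - m|)) * ENNReal.ofReal (Real.exp (a * |m|)) := by
  rw [← ENNReal.ofReal_mul (Real.exp_pos _).le, ← Real.exp_add]
  refine ENNReal.ofReal_le_ofReal (Real.exp_le_exp.2 ?_)
  rw [← mul_add]
  refine mul_le_mul_of_nonneg_left ?_ ha
  calc |x| = |x - m + m| := by ring_nf
    _ ≤ |x - m| + |m| := abs_add_le _ _

/-- **Glue `S1a → S1b → S1`**: the static centring bound (S1a, `|∫ X dG_N| ≤ y K (N+1)` eventually) and the centred pressure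
bet (S1b) give the registered slab pressure stub S1 `stub_slabPressure` verbatim (both used at level `y/2`; `K₀ ≥ 1`).
[folklore] -/
theorem slabPressure_of_centring_of_centred :
    (∃ η₀ : ℝ, 0 < η₀ ∧ ∀ θe : ℝ, 0 < θe → ∃ σ₀ : ℝ, 0 < σ₀ ∧ ∀ σ : ℝ, 0 < σ → σ < σ₀ →
      ∀ Φ : (N : ℕ) → HardSphereFlow (Torus.geometry (Fin 3)) (hsDiameter σ N) (N + 1),
      ∀ τ : ℝ, 0 < τ → ∀ χ : ℝ × UnitAddTorus (Fin 3) → ℝ, Continuous χ →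
      ∀ g : ℝ → ℝ, Continuous g → (∀ a, η₀ ≤ a → g a = 0) →
      ∀ Ψ : V3 × V3 × V3 → ℝ, Continuous Ψ → (∃ C : ℝ, ∀ q, |Ψ q| ≤ C) →
      (∀ (n v w : V3), ‖n‖ = 1 → Ψ (-n, (reflectVel n (v, w)).1, (reflectVel n (v, w)).2) = -Ψ (n, v, w)) →
      ∀ ϑ : ℝ, 0 < ϑ → ∀ y : ℝ, 0 < y →
      ∃ K₀ : ℕ, ∀ K : ℕ, K₀ ≤ K → ∃ N₀ : ℕ, ∀ N : ℕ, N₀ ≤ N →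
      ∀ s ∈ Set.Icc (0 : ℝ) τ, ∀ ℓ : ℝ,
        (K : ℝ) * ((N + 1 : ℕ) : ℝ) ^ (-(1 / 3 : ℝ)) / 2 ≤ ℓ → ℓ ≤ (K : ℝ) * ((N + 1 : ℕ) : ℝ) ^ (-(1 / 3 : ℝ)) →
        |∫ z, metroOddSum σ N (Φ N) (Set.Ioc 0 ℓ) (fun p => χ (p.1 + s, p.2)) g Ψ
            ((K : ℝ) ^ (1 / 4 : ℝ) * ((N + 1 : ℕ) : ℝ) ^ (-(1 / 3 : ℝ))) ϑ z
          ∂(localGibbsLaw σ (fun _ => 1) (fun _ => 0) (fun _ => θe) N (Φ N))|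
        ≤ y * K * ((N : ℝ) + 1)) →
    (∃ η₀ : ℝ, 0 < η₀ ∧ ∀ θe : ℝ, 0 < θe → ∃ σ₀ : ℝ, 0 < σ₀ ∧ ∀ σ : ℝ, 0 < σ → σ < σ₀ →
      ∀ Φ : (N : ℕ) → HardSphereFlow (Torus.geometry (Fin 3)) (hsDiameter σ N) (N + 1),
      ∀ τ : ℝ, 0 < τ → ∀ χ : ℝ × UnitAddTorus (Fin 3) → ℝ, Continuous χ →
      ∀ g : ℝ → ℝ, Continuous g → (∀ a, η₀ ≤ a → g a = 0) →
      ∀ Ψ : V3 × V3 × V3 → ℝ, Continuous Ψ → (∃ C : ℝ, ∀ q, |Ψ q| ≤ C) →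
      (∀ (n v w : V3), ‖n‖ = 1 → Ψ (-n, (reflectVel n (v, w)).1, (reflectVel n (v, w)).2) = -Ψ (n, v, w)) →
      ∀ ϑ : ℝ, 0 < ϑ → ∀ b y : ℝ, 0 < b → 0 < y →
      ∃ K₀ : ℕ, ∀ K : ℕ, K₀ ≤ K → ∃ N₀ : ℕ, ∀ N : ℕ, N₀ ≤ N →
      ∀ s ∈ Set.Icc (0 : ℝ) τ, ∀ ℓ : ℝ,
        (K : ℝ) * ((N + 1 : ℕ) : ℝ) ^ (-(1 / 3 : ℝ)) / 2 ≤ ℓ → ℓ ≤ (K : ℝ) * ((N + 1 : ℕ) : ℝ) ^ (-(1 / 3 : ℝ)) →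
      ∀ b' : ℝ, b / 2 ≤ b' → b' ≤ b →
        ∫⁻ z, ENNReal.ofReal (Real.exp (b' / K *
            |metroOddSum σ N (Φ N) (Set.Ioc 0 ℓ) (fun p => χ (p.1 + s, p.2)) g Ψ
                ((K : ℝ) ^ (1 / 4 : ℝ) * ((N + 1 : ℕ) : ℝ) ^ (-(1 / 3 : ℝ))) ϑ z -
              ∫ z', metroOddSum σ N (Φ N) (Set.Ioc 0 ℓ) (fun p => χ (p.1 + s, p.2)) g Ψ
                ((K : ℝ) ^ (1 / 4 : ℝ) * ((N + 1 : ℕ) : ℝ) ^ (-(1 / 3 : ℝ))) ϑ z'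
                ∂(localGibbsLaw σ (fun _ => 1) (fun _ => 0) (fun _ => θe) N (Φ N))|))
          ∂(localGibbsLaw σ (fun _ => 1) (fun _ => 0) (fun _ => θe) N (Φ N))
        ≤ ENNReal.ofReal (Real.exp (b' * y * ((N : ℝ) + 1)))) →
    (∃ η₀ : ℝ, 0 < η₀ ∧ ∀ θe : ℝ, 0 < θe → ∃ σ₀ : ℝ, 0 < σ₀ ∧ ∀ σ : ℝ, 0 < σ → σ < σ₀ →
      ∀ Φ : (N : ℕ) → HardSphereFlow (Torus.geometry (Fin 3)) (hsDiameter σ N) (N + 1),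
      ∀ τ : ℝ, 0 < τ → ∀ χ : ℝ × UnitAddTorus (Fin 3) → ℝ, Continuous χ →
      ∀ g : ℝ → ℝ, Continuous g → (∀ a, η₀ ≤ a → g a = 0) →
      ∀ Ψ : V3 × V3 × V3 → ℝ, Continuous Ψ → (∃ C : ℝ, ∀ q, |Ψ q| ≤ C) →
      (∀ (n v w : V3), ‖n‖ = 1 → Ψ (-n, (reflectVel n (v, w)).1, (reflectVel n (v, w)).2) = -Ψ (n, v, w)) →
      ∀ ϑ : ℝ, 0 < ϑ → ∀ b y : ℝ, 0 < b → 0 < y →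
      ∃ K₀ : ℕ, ∀ K : ℕ, K₀ ≤ K → ∃ N₀ : ℕ, ∀ N : ℕ, N₀ ≤ N →
      ∀ s ∈ Set.Icc (0 : ℝ) τ, ∀ ℓ : ℝ,
        (K : ℝ) * ((N + 1 : ℕ) : ℝ) ^ (-(1 / 3 : ℝ)) / 2 ≤ ℓ → ℓ ≤ (K : ℝ) * ((N + 1 : ℕ) : ℝ) ^ (-(1 / 3 : ℝ)) →
      ∀ b' : ℝ, b / 2 ≤ b' → b' ≤ b →
        ∫⁻ z, ENNReal.ofReal (Real.exp (b' / K *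
            |metroOddSum σ N (Φ N) (Set.Ioc 0 ℓ) (fun p => χ (p.1 + s, p.2)) g Ψ
              ((K : ℝ) ^ (1 / 4 : ℝ) * ((N + 1 : ℕ) : ℝ) ^ (-(1 / 3 : ℝ))) ϑ z|))
          ∂(localGibbsLaw σ (fun _ => 1) (fun _ => 0) (fun _ => θe) N (Φ N))
        ≤ ENNReal.ofReal (Real.exp (b' * y * ((N : ℝ) + 1)))) := by
  intro hA hB
  obtain ⟨η₁, hη₁, hA⟩ := hA
  obtain ⟨η₂, hη₂, hB⟩ := hB
  refine ⟨min η₁ η₂, lt_min hη₁ hη₂, fun θe hθe => ?_⟩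
  obtain ⟨σ₁, hσ₁, hA⟩ := hA θe hθe
  obtain ⟨σ₂, hσ₂, hB⟩ := hB θe hθe
  refine ⟨min σ₁ σ₂, lt_min hσ₁ hσ₂, ?_⟩
  intro σ hσ hσlt Φ τ hτ χ hχ g hg hg0 Ψ hΨ hΨb hΨodd ϑ hϑ b y hb hy
  have hσ₁' : σ < σ₁ := hσlt.trans_le (min_le_left _ _)
  have hσ₂' : σ < σ₂ := hσlt.trans_le (min_le_right _ _)
  have hg₁ : ∀ a, η₁ ≤ a → g a = 0 := fun a ha' => hg0 a ((min_le_left _ _).trans ha')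
  have hg₂ : ∀ a, η₂ ≤ a → g a = 0 := fun a ha' => hg0 a ((min_le_right _ _).trans ha')
  have hy2 : 0 < y / 2 := by positivity
  obtain ⟨K₁, hK₁⟩ := hA σ hσ hσ₁' Φ τ hτ χ hχ g hg hg₁ Ψ hΨ hΨb hΨodd ϑ hϑ (y / 2) hy2
  obtain ⟨K₂, hK₂⟩ := hB σ hσ hσ₂' Φ τ hτ χ hχ g hg hg₂ Ψ hΨ hΨb hΨodd ϑ hϑ b (y / 2) hb hy2
  refine ⟨max (max K₁ K₂) 1, fun K hK => ?_⟩
  have hK₁' : K₁ ≤ K := ((le_max_left _ _).trans (le_max_left _ _)).trans hK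
  have hK₂' : K₂ ≤ K := ((le_max_right _ _).trans (le_max_left _ _)).trans hK
  have hK1 : 1 ≤ K := (le_max_right _ _).trans hK
  have hKpos : (0 : ℝ) < K := by exact_mod_cast hK1
  obtain ⟨N₁, hN₁⟩ := hK₁ K hK₁'
  obtain ⟨N₂, hN₂⟩ := hK₂ K hK₂'
  refine ⟨max N₁ N₂, fun N hN => ?_⟩
  have hN₁' : N₁ ≤ N := (le_max_left _ _).trans hN
  have hN₂' : N₂ ≤ N := (le_max_right _ _).trans hN
  intro s hs ℓ hℓ1 hℓ2 b' hb1 hb2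
  have hb' : 0 < b' := by linarith
  have hN1 : (0 : ℝ) < (N : ℝ) + 1 := by positivity
  set G := localGibbsLaw σ (fun _ => 1) (fun _ => 0) (fun _ => θe) N (Φ N) with hG_def
  set X : Config (N + 1) (Fin 3) T3 → ℝ := fun z =>
    metroOddSum σ N (Φ N) (Set.Ioc 0 ℓ) (fun p => χ (p.1 + s, p.2)) g Ψ
      ((K : ℝ) ^ (1 / 4 : ℝ) * ((N + 1 : ℕ) : ℝ) ^ (-(1 / 3 : ℝ))) ϑ z with hX_def
  set m : ℝ := ∫ z', X z' ∂G with hm_def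
  have hmA : |m| ≤ y / 2 * K * ((N : ℝ) + 1) := hN₁ N hN₁' s hs ℓ hℓ1 hℓ2
  have hBB : ∫⁻ z, ENNReal.ofReal (Real.exp (b' / K * |X z - m|)) ∂G ≤
      ENNReal.ofReal (Real.exp (b' * (y / 2) * ((N : ℝ) + 1))) := hN₂ N hN₂' s hs ℓ hℓ1 hℓ2 b' hb1 hb2
  change ∫⁻ z, ENNReal.ofReal (Real.exp (b' / K * |X z|)) ∂G ≤ ENNReal.ofReal (Real.exp (b' * y * ((N : ℝ) + 1)))
  have ha : 0 ≤ b' / K := by positivity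
  have hcm : Real.exp (b' / K * |m|) ≤ Real.exp (b' * (y / 2) * ((N : ℝ) + 1)) := by
    refine Real.exp_le_exp.2 ?_
    calc b' / K * |m| ≤ b' / K * (y / 2 * K * ((N : ℝ) + 1)) := mul_le_mul_of_nonneg_left hmA ha
      _ = b' * (y / 2) * ((N : ℝ) + 1) := by field_simp
  calc ∫⁻ z, ENNReal.ofReal (Real.exp (b' / K * |X z|)) ∂G
      ≤ ∫⁻ z, ENNReal.ofReal (Real.exp (b' / K * |X z - m|)) * ENNReal.ofReal (Real.exp (b' / K * |m|)) ∂G :=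
        lintegral_mono fun z => ofReal_exp_mul_abs_le _ _ _ ha
    _ = (∫⁻ z, ENNReal.ofReal (Real.exp (b' / K * |X z - m|)) ∂G) * ENNReal.ofReal (Real.exp (b' / K * |m|)) :=
        lintegral_mul_const' _ _ ENNReal.ofReal_ne_top
    _ ≤ ENNReal.ofReal (Real.exp (b' * (y / 2) * ((N : ℝ) + 1))) *
          ENNReal.ofReal (Real.exp (b' * (y / 2) * ((N : ℝ) + 1))) :=
        mul_le_mul' hBB (ENNReal.ofReal_le_ofReal hcm)
    _ = ENNReal.ofReal (Real.exp (b' * y * ((N : ℝ) + 1))) := by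
        rw [← ENNReal.ofReal_mul (Real.exp_pos _).le, ← Real.exp_add]
        congr 1; congr 1; ring

end Summit.AtomisticToContinuum.HydrodynamicLimit.Theorems.OddContactSymmetryKineticSlab

end
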